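import Summits.SmoothPoincare4.SmoothPoincare4.Theses.EntropyRung
import Summits.SmoothPoincare4.SmoothPoincare4.Theorems.EntropyRungNoncompactShrinkerGapStubCompactSupportLSI
import Summits.SmoothPoincare4.SmoothPoincare4.Theorems.EntropyRungNoncompactShrinkerGapStubModelValueSplitLine
import Summits.SmoothPoincare4.SmoothPoincare4.Theorems.EntropyRungNoncompactShrinkerGapStubTransplantComparison
import Summits.SmoothPoincare4.SmoothPoincare4.Theorems.EntropyRungNoncompactShrinkerGapStubThreeShrinkerGap
import Literature.Geometry.Riemannian.ThreeShrinkerClassification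
import Literature.Geometry.Riemannian.ShrinkerEntropy
import Literature.Geometry.Riemannian.ShrinkerSplittingAtInfinity
import Literature.Geometry.Riemannian.ShrinkerPotentialGrowth

/-!
# `EntropyRung.NoncompactShrinkerGap` (stmt-SmoothPoincare4-10868): the reduction of line `collapsed-ends-usc`

Helper file (`--supports stmt-SmoothPoincare4-10868`) recording, as importable theorems, what the crux line
`collapsed-ends-usc` (skeleton `Cruxes/NoncompactShrinkerGap/Lines/collapsed_ends_usc.lean`, v4) has PROVED about
the crux

> a complete connected non-compact non-flat 4-d gradient shrinking Ricci soliton `Ric + Hess f = g/2`, normalised by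
> `R + |∇f|² = f`, has `∫ e^{-f} dV ≤ 32π²√π e^{-3/2} = (4π)² Θ(S³×ℝ)`.

Bernstein–Wang's partially-collapsed-shrinker theorem (Bernstein–Wang 2016, Thm. 1.2), transplanted to Ricci
shrinkers with Perelman's `μ(·, 1) = log Θ` in place of the Colding–Minicozzi entropy: along a NON-DECAYING direction
of BOUNDED scalar curvature the soliton splits at infinity as `N³ × ℝ` with `N` a complete non-flat normalised 3-d
shrinker, `μ(·, 1)` is upper semicontinuous towards the split limit (transplanted cut-offs of the product minimiser),
and the 3-d classification caps `Θ₃(N) ≤ Θ₃(S³) = Θ₄(S³ × ℝ)`. The three analytic steps of the semicontinuity are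
LANDED theorems of the tree (`stub_compactSupportLSI` p93740, `stub_modelValueSplitLine` p90822,
`stub_transplantComparison` p93265) and the 3-d rung is landed modulo the classification (p87530); this file composes
them. Everything is stated over the route's fact-free vocabulary, fully unfolded (no definitions).

* `collapsedDirectionReduction_of_facts` — THE LEVER: given the named facts F1 `shrinkerSplittingAtInfinity_four`
  (Munteanu–Wang 2015 + Enders–Müller–Topping 2011 + Naber 2010 + Bertellotti–Buzano 2025), F2
  `shrinkerPotentialGrowth` (Haslhofer–Müller 2011 §2) and CN `CarrilloNi2009_shrinkerLSI` (Carrillo–Ni 2009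
  Thm. 1.1 / §4), a crux datum with bounded, non-decaying scalar curvature admits a complete non-flat normalised 3-d
  shrinker `(N, h, φ)` with `∫_M e^{-f} dV_g ≤ 2√π ∫_N e^{-φ} dV_h`.
* `nonDecayingGap_of_facts` — THE MIDDLE CASE OF THE CRUX, modulo F3 `threeShrinkerClassification_modelData`
  (Munteanu–Wang 2019 Thm. 1.2 / Cao–Chen–Zhu 2008), F1, F2, CN: every crux datum with bounded non-decaying scalar
  curvature obeys `∫ e^{-f} dV ≤ 32π²√π e^{-3/2}` (equality for the round cylinder `S³(2) × ℝ`: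
  `Cruxes/…/Disproof.lean`, `tight_at_cylinder`).
* `noncompactShrinkerGap_of_residues` — THE COMPOSITION: F3, F1, F2, CN together with the two residual statements of
  the line — `ConicalGap` (the crux on data with `R → 0` at infinity: the asymptotically conical class, the
  recognised open core) and `UnboundedCurvatureGap` (the crux on data with `sup R = ∞`) — imply
  `EntropyRung.NoncompactShrinkerGap` by the trichotomy on the scalar curvature at infinity. Both residues are strict
  special cases of the crux (`conicalGap_of_noncompactShrinkerGap`, `unboundedCurvatureGap_of_noncompactShrinkerGap`).

This is a CONDITIONAL record (`--supports`): it closes nothing by itself; the crux item stays open on the two residues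
and the four named facts (each with a `…Proofs.lean` reduction programme under `Literature/Geometry/Riemannian/`).

## References

* J. Bernstein, L. Wang, *A sharp lower bound for the entropy of closed hypersurfaces up to dimension six*,
  Invent. Math. 206 (2016), Thm. 1.2, Cor. 6.6. [BernsteinWang2016]
* O. Munteanu, J. Wang, arXiv:1606.01861 = Ann. Sci. ÉNS 52 (2019), Thms. 1.2–1.4, proof of Thm. 5.1.
  [MunteanuWang2019]
* A. Naber, *Noncompact shrinking four solitons with nonnegative curvature*, J. reine angew. Math. 645 (2010),
  Lemma 4.1, Props. 4.1–4.2. [Naber2010]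
* J. A. Carrillo, L. Ni, Comm. Anal. Geom. 17 (2009), Thm. 1.1, §4. [CarrilloNi2009]
* R. Haslhofer, R. Müller, GAFA 21 (2011), §2. [HaslhoferMuller2011]
* H.-D. Cao, R. S. Hamilton, T. Ilmanen, arXiv:math/0404165 (2004), §§3–4 (density table). [CaoHamiltonIlmanen2004]
-/

noncomputable section

-- the prescribed namespace `Summit.<Summit>.<Problem>.…` repeats `SmoothPoincare4` (summit = problem)
set_option linter.dupNamespace false

namespace Summit.SmoothPoincare4.SmoothPoincare4.Theorems.NoncompactShrinkerGapReduction

open scoped Manifold ContDiff ENNReal NNReal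
open MeasureTheory Set
open Literature.Geometry.Lorentzian Literature.Geometry.Riemannian

/-! ## Elementary helpers -/

/-- `log (a x) ≤ log (a y) + 2ε` for all `ε > 0`, with `a, x, y > 0`, forces `x ≤ y`. [folklore] -/
theorem le_of_forall_log_mul_le {a x y : ℝ} (ha : 0 < a) (hx : 0 < x) (hy : 0 < y)
    (h : ∀ ε : ℝ, 0 < ε → Real.log (a * x) ≤ Real.log (a * y) + 2 * ε) : x ≤ y := by
  have hle : Real.log (a * x) ≤ Real.log (a * y) :=
    le_of_forall_pos_le_add fun ε hε ↦ by linarith [h (ε / 2) (by positivity)]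
  exact le_of_mul_le_mul_left ((Real.log_le_log_iff (mul_pos ha hx) (mul_pos ha hy)).1 hle) ha

/-- Negation bookkeeping: "`S` does not tend to `0` at infinity" in the positive form consumed by the lever.
[folklore] -/
theorem exists_nondecaying_of_not_flatAtInfinity {M : Type} {S : M → ℝ} {IsCpt : Set M → Prop}
    (h : ¬ ∀ ε : ℝ, 0 < ε → ∃ K : Set M, IsCpt K ∧ ∀ x, x ∉ K → S x < ε) :
    ∃ ε : ℝ, 0 < ε ∧ ∀ K : Set M, IsCpt K → ∃ x, x ∉ K ∧ ε ≤ S x := by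
  by_contra hcon
  apply h
  intro ε hε
  by_contra hK
  apply hcon
  refine ⟨ε, hε, fun K hKc => ?_⟩
  by_contra hx
  apply hK
  refine ⟨K, hKc, fun x hxK => ?_⟩
  by_contra hlt
  exact hx ⟨x, hxK, not_lt.mp hlt⟩

section Conversions

variable {E : Type*} [NormedAddCommGroup E] [NormedSpace ℝ E] [FiniteDimensional ℝ E]
  {H : Type*} [TopologicalSpace H] {I : ModelWithCorners ℝ E H} {M : Type*} [TopologicalSpace M]
  [ChartedSpace H M] [IsManifold I ∞ M] [T3Space M] [MeasurableSpace M] [BorelSpace M]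

omit [T3Space M] [MeasurableSpace M] [BorelSpace M] in
/-- Closed `edist`-balls compact ⇒ closed `riemEDist`-balls compact (`riemEDist` is `edist` for a Riemannian
metric): the route's completeness hypothesis in the form consumed by `CarrilloNi2009_shrinkerLSI`. [folklore] -/
theorem isCompact_riemEDist_closedBall_of_edist
    {g : PseudoRiemannianMetric I ∞ E (TangentSpace I : M → Type _)} (hg : g.IsRiemannian)
    (hc : ∀ (x : M) (r : NNReal), IsCompact {y : M | g.edist hg x y ≤ r}) (x : M) (r : NNReal) :
    IsCompact {y : M | g.riemEDist x y ≤ r} := by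
  simpa [PseudoRiemannianMetric.riemEDist_eq hg] using hc x r

/-- The Bochner integral of `e^{-f}` is positive on a nonempty boundaryless Riemannian manifold when `e^{-f}` is
integrable (the Riemannian measure charges `univ`). [folklore] -/
theorem integral_exp_neg_pos [I.Boundaryless] [Nonempty M]
    {g : PseudoRiemannianMetric I ∞ E (TangentSpace I : M → Type _)} (hg : g.IsRiemannian)
    {f : M → ℝ} (hf : Integrable (fun x ↦ Real.exp (-f x)) g.riemVolume) :
    0 < ∫ x, Real.exp (-f x) ∂g.riemVolume := by
  rw [integral_pos_iff_support_of_nonneg (fun x ↦ (Real.exp_pos _).le) hf]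
  have : Function.support (fun x ↦ Real.exp (-f x)) = univ := by ext x; simp [Real.exp_ne_zero]
  simpa [this] using PseudoRiemannianMetric.riemVolume_univ_pos hg

/-- `∫⁻ ofReal (e^{-f}) dV = ofReal (∫ e^{-f} dV)` against the route's measure
`riemannianMeasure (g.toContMDiffRiemannianMetric hg) = g.riemVolume`, for integrable `e^{-f}`. [folklore] -/
theorem lintegral_exp_neg_eq_ofReal_integral
    {g : PseudoRiemannianMetric I ∞ E (TangentSpace I : M → Type _)} (hg : g.IsRiemannian)
    {f : M → ℝ} (hf : Integrable (fun x ↦ Real.exp (-f x)) g.riemVolume) :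
    ∫⁻ x, ENNReal.ofReal (Real.exp (-f x)) ∂(riemannianMeasure (g.toContMDiffRiemannianMetric hg)) =
      ENNReal.ofReal (∫ x, Real.exp (-f x) ∂g.riemVolume) := by
  rw [← PseudoRiemannianMetric.riemVolume_eq hg,
    ofReal_integral_eq_lintegral_ofReal hf (ae_of_all _ fun x ↦ (Real.exp_pos _).le)]

end Conversions

/-- **The B–W arithmetic** `Θ₄(N × ℝ) = Θ₃(N)`: `2√π · 16π²e^{-3/2} = 32π²√π e^{-3/2}` — the crux constant IS the
3-d sphere's weighted volume times the line's Gaussian factor `∫_ℝ e^{-z²/4} dz = 2√π`, as extended reals.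
[cite: CaoHamiltonIlmanen2004, §3] -/
theorem lineFactor_mul_threeBound :
    ENNReal.ofReal (2 * Real.sqrt Real.pi) * ENNReal.ofReal (16 * Real.pi ^ 2 * Real.exp (-(3 : ℝ) / 2)) =
      ENNReal.ofReal (32 * Real.pi ^ 2 * Real.sqrt Real.pi * Real.exp (-(3 : ℝ) / 2)) := by
  rw [← ENNReal.ofReal_mul (by positivity)]
  congr 1
  ring

/-! ## The lever: upper semicontinuity of the density towards the split limit -/

/-- **The lever of line `collapsed-ends-usc`** (Bernstein–Wang 2016 Thm. 1.2 / Cor. 6.6, transplanted): modulo the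
named facts F1 `shrinkerSplittingAtInfinity_four`, F2 `shrinkerPotentialGrowth`, CN `CarrilloNi2009_shrinkerLSI`, a
complete connected non-compact non-flat normalised 4-d gradient shrinker whose scalar curvature is BOUNDED and does
NOT decay at infinity admits a complete connected non-flat normalised 3-d gradient shrinker `(N, h, φ)` with
`∫_M e^{-f} dV_g ≤ 2√π · ∫_N e^{-φ} dV_h`. Proof: F1 supplies `N` and, for every `R, η`, an `η`-transplant of the
piece `{φ < R} × (−R, R)` of `N × ℝ` into `M`; for each `ε > 0` the landed U2 picks a cut-off `W` of the product
minimiser with functional `≤ log((4π)⁻² 2√π ∫_N e^{-φ}) + ε`, the landed U3 an admissible `η` and the transplanted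
test function `w` on `M` with functional at most that of `W` plus `ε`, and the landed U1 (Carrillo–Ni for compactly
supported densities) gives `log((4π)⁻² ∫_M e^{-f}) ≤` functional of `w`; let `ε → 0`. Integrability and positivity
of both integrals are Carrillo–Ni (i). [cite: BernsteinWang2016, Thm 1.2, Cor 6.6]
[cite: MunteanuWang2019, proof of Thm 5.1 (p. 21)] -/
theorem collapsedDirectionReduction_of_facts (hsplit : shrinkerSplittingAtInfinity_four)
    (hgrowth : shrinkerPotentialGrowth) (hCN : CarrilloNi2009_shrinkerLSI)
    (M : Type) [TopologicalSpace M] [T2Space M] [SecondCountableTopology M]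
    [ChartedSpace (EuclideanSpace ℝ (Fin 4)) M] [IsManifold (𝓡 4) ∞ M] [ConnectedSpace M] [NoncompactSpace M]
    [T3Space M] [MeasurableSpace M] [BorelSpace M]
    (g : PseudoRiemannianMetric (𝓡 4) ∞ (EuclideanSpace ℝ (Fin 4)) (TangentSpace (𝓡 4) : M → Type _))
    [g.HasLeviCivita] (f : M → ℝ) (hg : g.IsRiemannian)
    (hc : ∀ (x : M) (r : NNReal), IsCompact {y : M | g.edist hg x y ≤ r})
    (hf : ContMDiff (𝓡 4) 𝓘(ℝ, ℝ) ∞ f)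
    (hsol : ∀ (x : M) (X Y : TangentSpace (𝓡 4) x),
      g.ricci x X Y + g.hessian f x X Y = (1 / 2 : ℝ) * g.val x X Y)
    (hnorm : ∀ x : M, g.scalarCurvature x + g.gradSq f x = f x)
    (hnf : ∃ x : M, g.scalarCurvature x ≠ 0)
    (hbdd : ∃ C : ℝ, ∀ x : M, g.scalarCurvature x ≤ C)
    (hnd : ∃ ε : ℝ, 0 < ε ∧ ∀ K : Set M, IsCompact K → ∃ x, x ∉ K ∧ ε ≤ g.scalarCurvature x) :
    ∃ (N : Type) (_ : TopologicalSpace N) (_ : T2Space N) (_ : SecondCountableTopology N)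
      (_ : ChartedSpace (EuclideanSpace ℝ (Fin 3)) N) (_ : IsManifold (𝓡 3) ∞ N) (_ : ConnectedSpace N)
      (_ : T3Space N) (_ : MeasurableSpace N) (_ : BorelSpace N)
      (h : PseudoRiemannianMetric (𝓡 3) ∞ (EuclideanSpace ℝ (Fin 3)) (TangentSpace (𝓡 3) : N → Type _))
      (_ : h.HasLeviCivita) (φ : N → ℝ) (hh : h.IsRiemannian),
      (∀ (x : N) (r : NNReal), IsCompact {y : N | h.edist hh x y ≤ r}) ∧
      ContMDiff (𝓡 3) 𝓘(ℝ, ℝ) ∞ φ ∧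
      (∀ (x : N) (X Y : TangentSpace (𝓡 3) x),
        h.ricci x X Y + h.hessian φ x X Y = (1 / 2 : ℝ) * h.val x X Y) ∧
      (∀ x : N, h.scalarCurvature x + h.gradSq φ x = φ x) ∧
      (∃ x : N, h.scalarCurvature x ≠ 0) ∧
      ∫⁻ x, ENNReal.ofReal (Real.exp (-f x)) ∂(riemannianMeasure (g.toContMDiffRiemannianMetric hg)) ≤
        ENNReal.ofReal (2 * Real.sqrt Real.pi) *
          ∫⁻ x, ENNReal.ofReal (Real.exp (-φ x)) ∂(riemannianMeasure (h.toContMDiffRiemannianMetric hh)) := by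
  obtain ⟨N, tN, t2N, scN, chN, mN, cN, t3N, msN, bN, h, lcN, φ, hh, hcN, hφ, hsolN, hnormN, hnfN,
    htrans⟩ := hsplit M g f hg hc hf hsol hnorm hnf hbdd hnd
  refine ⟨N, tN, t2N, scN, chN, mN, cN, t3N, msN, bN, h, lcN, φ, hh, hcN, hφ, hsolN, hnormN, hnfN, ?_⟩
  -- Carrillo–Ni (i) on `M` (`n = 4`) and on `N` (`n = 3`): `e^{-f}`, `e^{-φ}` are integrable
  have hAi : Integrable (fun x ↦ Real.exp (-f x)) g.riemVolume :=
    (hCN 4 M g f hg (isCompact_riemEDist_closedBall_of_edist hg hc) hf hsol hnorm).1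
  have hBi : Integrable (fun y ↦ Real.exp (-φ y)) h.riemVolume :=
    (hCN 3 N h φ hh (isCompact_riemEDist_closedBall_of_edist hh hcN) hφ hsolN hnormN).1
  have hApos : 0 < ∫ x, Real.exp (-f x) ∂g.riemVolume := integral_exp_neg_pos hg hAi
  have hBpos : 0 < ∫ y, Real.exp (-φ y) ∂h.riemVolume := integral_exp_neg_pos hh hBi
  have h2sqrtpi : 0 < 2 * Real.sqrt Real.pi := by positivity
  have hapos : 0 < (4 * Real.pi) ^ (-(4 : ℝ) / 2) := Real.rpow_pos_of_pos (by positivity) _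
  -- the real inequality `∫_M e^{-f} ≤ 2√π ∫_N e^{-φ}` from U1–U3, `ε` at a time
  have hmain : ∫ x, Real.exp (-f x) ∂g.riemVolume ≤
      2 * Real.sqrt Real.pi * ∫ y, Real.exp (-φ y) ∂h.riemVolume := by
    refine le_of_forall_log_mul_le hapos hApos (mul_pos h2sqrtpi hBpos) fun ε hε ↦ ?_
    obtain ⟨R, W, hWs, hWc, hWsupp, hWZ, hWval⟩ :=
      NoncompactShrinkerGapModelValueSplitLine.stub_modelValueSplitLine hgrowth hCN N h φ hh hcN hφ hsolN
        hnormN ε hε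
    obtain ⟨η, hη, hη'⟩ :=
      NoncompactShrinkerGapTransplantComparison.stub_transplantComparison M g hg N h hh φ R W hWs hWc hWsupp
        hWZ ε hε
    obtain ⟨U, Φ, Ψ, hU, hsub, hΦ, hΦU, hΨ, hinv, hqi, hscal⟩ := htrans R η hη
    obtain ⟨w, hws, hwc, hwZ, hwval⟩ := hη' U Φ Ψ hU hsub hΦ hΦU hΨ hinv hqi hscal
    have h1 := NoncompactShrinkerGapCompactSupportLSI.stub_compactSupportLSI hgrowth hCN M g f hg hc hf hsol
      hnorm hbdd w hws hwc hwZ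
    linarith
  -- conversion to the route's `lintegral`s
  rw [lintegral_exp_neg_eq_ofReal_integral hg hAi, lintegral_exp_neg_eq_ofReal_integral hh hBi,
    ← ENNReal.ofReal_mul h2sqrtpi.le]
  exact ENNReal.ofReal_le_ofReal hmain

/-! ## The middle case of the crux -/

/-- **The crux on the bounded, non-decaying class** (= `cylindrical-blowdown`'s `NonDecayingScalarGap`; Disproof
docblock §3(i)), modulo the four named facts F3 `threeShrinkerClassification_modelData`, F1
`shrinkerSplittingAtInfinity_four`, F2 `shrinkerPotentialGrowth`, CN `CarrilloNi2009_shrinkerLSI`: a complete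
connected non-compact non-flat normalised 4-d gradient shrinker whose scalar curvature is bounded and does not decay
at infinity has `∫ e^{-f} dV ≤ 32π²√π e^{-3/2} = (4π)² Θ(S³ × ℝ)` — `∫_M e^{-f} ≤ 2√π ∫_N e^{-φ}` (the lever)
`≤ 2√π · 16π² e^{-3/2}` (the 3-d rung, landed `threeShrinkerGap_of_classification`). Sharp: equality for the round
cylinder `S³(2) × ℝ`, whose split limit is `N = S³(2)`. [cite: BernsteinWang2016, Thm 1.2]
[cite: MunteanuWang2019, Thm 1.2, proof of Thm 5.1] [cite: CaoHamiltonIlmanen2004, §§3–4] -/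
theorem nonDecayingGap_of_facts (hcl : threeShrinkerClassification_modelData)
    (hsplit : shrinkerSplittingAtInfinity_four) (hgrowth : shrinkerPotentialGrowth)
    (hCN : CarrilloNi2009_shrinkerLSI)
    (M : Type) [TopologicalSpace M] [T2Space M] [SecondCountableTopology M]
    [ChartedSpace (EuclideanSpace ℝ (Fin 4)) M] [IsManifold (𝓡 4) ∞ M] [ConnectedSpace M] [NoncompactSpace M]
    [T3Space M] [MeasurableSpace M] [BorelSpace M]
    (g : PseudoRiemannianMetric (𝓡 4) ∞ (EuclideanSpace ℝ (Fin 4)) (TangentSpace (𝓡 4) : M → Type _))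
    [g.HasLeviCivita] (f : M → ℝ) (hg : g.IsRiemannian)
    (hc : ∀ (x : M) (r : NNReal), IsCompact {y : M | g.edist hg x y ≤ r})
    (hf : ContMDiff (𝓡 4) 𝓘(ℝ, ℝ) ∞ f)
    (hsol : ∀ (x : M) (X Y : TangentSpace (𝓡 4) x),
      g.ricci x X Y + g.hessian f x X Y = (1 / 2 : ℝ) * g.val x X Y)
    (hnorm : ∀ x : M, g.scalarCurvature x + g.gradSq f x = f x)
    (hnf : ∃ x : M, g.scalarCurvature x ≠ 0)
    (hbdd : ∃ C : ℝ, ∀ x : M, g.scalarCurvature x ≤ C)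
    (hnd : ∃ ε : ℝ, 0 < ε ∧ ∀ K : Set M, IsCompact K → ∃ x, x ∉ K ∧ ε ≤ g.scalarCurvature x) :
    ∫⁻ x, ENNReal.ofReal (Real.exp (-f x)) ∂(riemannianMeasure (g.toContMDiffRiemannianMetric hg)) ≤
      ENNReal.ofReal (32 * Real.pi ^ 2 * Real.sqrt Real.pi * Real.exp (-(3 : ℝ) / 2)) := by
  obtain ⟨N, _, _, _, _, _, _, _, _, _, h, _, φ, hh, hcN, hφ, hsolN, hnormN, hnfN, hZ⟩ :=
    collapsedDirectionReduction_of_facts hsplit hgrowth hCN M g f hg hc hf hsol hnorm hnf hbdd hnd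
  have h3 : ∫⁻ x, ENNReal.ofReal (Real.exp (-φ x)) ∂(riemannianMeasure (h.toContMDiffRiemannianMetric hh))
      ≤ ENNReal.ofReal (16 * Real.pi ^ 2 * Real.exp (-(3 : ℝ) / 2)) :=
    NoncompactShrinkerGapThreeShrinkerGap.threeShrinkerGap_of_classification hcl N h φ hh hcN hφ hsolN hnormN hnfN
  calc ∫⁻ x, ENNReal.ofReal (Real.exp (-f x)) ∂(riemannianMeasure (g.toContMDiffRiemannianMetric hg))
      ≤ ENNReal.ofReal (2 * Real.sqrt Real.pi) * ∫⁻ x, ENNReal.ofReal (Real.exp (-φ x))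
          ∂(riemannianMeasure (h.toContMDiffRiemannianMetric hh)) := hZ
    _ ≤ ENNReal.ofReal (2 * Real.sqrt Real.pi) * ENNReal.ofReal (16 * Real.pi ^ 2 * Real.exp (-(3 : ℝ) / 2)) := by
        gcongr
    _ = ENNReal.ofReal (32 * Real.pi ^ 2 * Real.sqrt Real.pi * Real.exp (-(3 : ℝ) / 2)) :=
        lineFactor_mul_threeBound

/-! ## The two residues are special cases of the crux -/

/-- The residue `ConicalGap` of the line (the crux restricted to data whose scalar curvature tends to `0` at
infinity — the asymptotically conical class, Munteanu–Wang 2019 Thm. 1.4) is a SPECIAL CASE of the crux: forget the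
decay hypothesis. [folklore] -/
theorem conicalGap_of_noncompactShrinkerGap
    (hcrux : Summit.SmoothPoincare4.SmoothPoincare4.Theses.EntropyRung.NoncompactShrinkerGap)
    (M : Type) [TopologicalSpace M] [T2Space M] [SecondCountableTopology M]
    [ChartedSpace (EuclideanSpace ℝ (Fin 4)) M] [IsManifold (𝓡 4) ∞ M] [ConnectedSpace M] [NoncompactSpace M]
    [T3Space M] [MeasurableSpace M] [BorelSpace M]
    (g : PseudoRiemannianMetric (𝓡 4) ∞ (EuclideanSpace ℝ (Fin 4)) (TangentSpace (𝓡 4) : M → Type _))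
    [g.HasLeviCivita] (f : M → ℝ) (hg : g.IsRiemannian)
    (hc : ∀ (x : M) (r : NNReal), IsCompact {y : M | g.edist hg x y ≤ r})
    (hf : ContMDiff (𝓡 4) 𝓘(ℝ, ℝ) ∞ f)
    (hsol : ∀ (x : M) (X Y : TangentSpace (𝓡 4) x),
      g.ricci x X Y + g.hessian f x X Y = (1 / 2 : ℝ) * g.val x X Y)
    (hnorm : ∀ x : M, g.scalarCurvature x + g.gradSq f x = f x)
    (hnf : ∃ x : M, g.scalarCurvature x ≠ 0)
    (_hdecay : ∀ ε : ℝ, 0 < ε → ∃ K : Set M, IsCompact K ∧ ∀ x, x ∉ K → g.scalarCurvature x < ε) :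
    ∫⁻ x, ENNReal.ofReal (Real.exp (-f x)) ∂(riemannianMeasure (g.toContMDiffRiemannianMetric hg)) ≤
      ENNReal.ofReal (32 * Real.pi ^ 2 * Real.sqrt Real.pi * Real.exp (-(3 : ℝ) / 2)) :=
  hcrux M g f hg hc hf hsol hnorm hnf

/-- The residue `UnboundedCurvatureGap` of the line (the crux restricted to data with `sup R = ∞`) is a SPECIAL
CASE of the crux: forget the unboundedness hypothesis. [folklore] -/
theorem unboundedCurvatureGap_of_noncompactShrinkerGap
    (hcrux : Summit.SmoothPoincare4.SmoothPoincare4.Theses.EntropyRung.NoncompactShrinkerGap)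
    (M : Type) [TopologicalSpace M] [T2Space M] [SecondCountableTopology M]
    [ChartedSpace (EuclideanSpace ℝ (Fin 4)) M] [IsManifold (𝓡 4) ∞ M] [ConnectedSpace M] [NoncompactSpace M]
    [T3Space M] [MeasurableSpace M] [BorelSpace M]
    (g : PseudoRiemannianMetric (𝓡 4) ∞ (EuclideanSpace ℝ (Fin 4)) (TangentSpace (𝓡 4) : M → Type _))
    [g.HasLeviCivita] (f : M → ℝ) (hg : g.IsRiemannian)
    (hc : ∀ (x : M) (r : NNReal), IsCompact {y : M | g.edist hg x y ≤ r})
    (hf : ContMDiff (𝓡 4) 𝓘(ℝ, ℝ) ∞ f)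
    (hsol : ∀ (x : M) (X Y : TangentSpace (𝓡 4) x),
      g.ricci x X Y + g.hessian f x X Y = (1 / 2 : ℝ) * g.val x X Y)
    (hnorm : ∀ x : M, g.scalarCurvature x + g.gradSq f x = f x)
    (hnf : ∃ x : M, g.scalarCurvature x ≠ 0)
    (_hunb : ¬ ∃ C : ℝ, ∀ x : M, g.scalarCurvature x ≤ C) :
    ∫⁻ x, ENNReal.ofReal (Real.exp (-f x)) ∂(riemannianMeasure (g.toContMDiffRiemannianMetric hg)) ≤
      ENNReal.ofReal (32 * Real.pi ^ 2 * Real.sqrt Real.pi * Real.exp (-(3 : ℝ) / 2)) :=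
  hcrux M g f hg hc hf hsol hnorm hnf

/-! ## The composition -/

/-- **`NoncompactShrinkerGap` from the four named facts and the two residues** (the composition of line
`collapsed-ends-usc`, v4): given F3 `threeShrinkerClassification_modelData`, F1 `shrinkerSplittingAtInfinity_four`, F2
`shrinkerPotentialGrowth`, CN `CarrilloNi2009_shrinkerLSI`, the residue `ConicalGap` (fifth hypothesis: the crux for
data with `R → 0` at infinity) and the residue `UnboundedCurvatureGap` (sixth hypothesis: the crux for data with
`sup R = ∞`), the crux `EntropyRung.NoncompactShrinkerGap` follows by the trichotomy on the scalar curvature at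
infinity — unbounded: the sixth hypothesis; bounded and decaying: the fifth; bounded and non-decaying:
`nonDecayingGap_of_facts`. Conditional record; closes nothing by itself. [cite: BernsteinWang2016, Thm 1.2]
[cite: MunteanuWang2019, Thms 1.2–1.4] -/
theorem noncompactShrinkerGap_of_residues (hcl : threeShrinkerClassification_modelData)
    (hsplit : shrinkerSplittingAtInfinity_four) (hgrowth : shrinkerPotentialGrowth)
    (hCN : CarrilloNi2009_shrinkerLSI)
    (hC : ∀ (M : Type) [TopologicalSpace M] [T2Space M] [SecondCountableTopology M]
      [ChartedSpace (EuclideanSpace ℝ (Fin 4)) M] [IsManifold (𝓡 4) ∞ M] [ConnectedSpace M] [NoncompactSpace M]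
      [T3Space M] [MeasurableSpace M] [BorelSpace M]
      (g : PseudoRiemannianMetric (𝓡 4) ∞ (EuclideanSpace ℝ (Fin 4)) (TangentSpace (𝓡 4) : M → Type _))
      [g.HasLeviCivita] (f : M → ℝ) (hg : g.IsRiemannian),
      (∀ (x : M) (r : NNReal), IsCompact {y : M | g.edist hg x y ≤ r}) →
      ContMDiff (𝓡 4) 𝓘(ℝ, ℝ) ∞ f →
      (∀ (x : M) (X Y : TangentSpace (𝓡 4) x),
        g.ricci x X Y + g.hessian f x X Y = (1 / 2 : ℝ) * g.val x X Y) →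
      (∀ x : M, g.scalarCurvature x + g.gradSq f x = f x) →
      (∃ x : M, g.scalarCurvature x ≠ 0) →
      (∀ ε : ℝ, 0 < ε → ∃ K : Set M, IsCompact K ∧ ∀ x, x ∉ K → g.scalarCurvature x < ε) →
      ∫⁻ x, ENNReal.ofReal (Real.exp (-f x)) ∂(riemannianMeasure (g.toContMDiffRiemannianMetric hg)) ≤
        ENNReal.ofReal (32 * Real.pi ^ 2 * Real.sqrt Real.pi * Real.exp (-(3 : ℝ) / 2)))
    (hD : ∀ (M : Type) [TopologicalSpace M] [T2Space M] [SecondCountableTopology M]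
      [ChartedSpace (EuclideanSpace ℝ (Fin 4)) M] [IsManifold (𝓡 4) ∞ M] [ConnectedSpace M] [NoncompactSpace M]
      [T3Space M] [MeasurableSpace M] [BorelSpace M]
      (g : PseudoRiemannianMetric (𝓡 4) ∞ (EuclideanSpace ℝ (Fin 4)) (TangentSpace (𝓡 4) : M → Type _))
      [g.HasLeviCivita] (f : M → ℝ) (hg : g.IsRiemannian),
      (∀ (x : M) (r : NNReal), IsCompact {y : M | g.edist hg x y ≤ r}) →
      ContMDiff (𝓡 4) 𝓘(ℝ, ℝ) ∞ f →
      (∀ (x : M) (X Y : TangentSpace (𝓡 4) x),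
        g.ricci x X Y + g.hessian f x X Y = (1 / 2 : ℝ) * g.val x X Y) →
      (∀ x : M, g.scalarCurvature x + g.gradSq f x = f x) →
      (∃ x : M, g.scalarCurvature x ≠ 0) →
      (¬ ∃ C : ℝ, ∀ x : M, g.scalarCurvature x ≤ C) →
      ∫⁻ x, ENNReal.ofReal (Real.exp (-f x)) ∂(riemannianMeasure (g.toContMDiffRiemannianMetric hg)) ≤
        ENNReal.ofReal (32 * Real.pi ^ 2 * Real.sqrt Real.pi * Real.exp (-(3 : ℝ) / 2))) :
    Summit.SmoothPoincare4.SmoothPoincare4.Theses.EntropyRung.NoncompactShrinkerGap := by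
  intro M _ _ _ _ _ _ _ _ _ _ g _ f hg hc hf hsol hnorm hnf
  by_cases hbdd : ∃ C : ℝ, ∀ x : M, g.scalarCurvature x ≤ C
  · by_cases hflat : ∀ ε : ℝ, 0 < ε → ∃ K : Set M, IsCompact K ∧ ∀ x, x ∉ K → g.scalarCurvature x < ε
    · exact hC M g f hg hc hf hsol hnorm hnf hflat
    · exact nonDecayingGap_of_facts hcl hsplit hgrowth hCN M g f hg hc hf hsol hnorm hnf hbdd
        (exists_nondecaying_of_not_flatAtInfinity hflat)
  · exact hD M g f hg hc hf hsol hnorm hnf hbdd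

/-! ## Registered forms (sub-goal stubs of the crux item, one-line signatures) -/

/-- Registered form of `nonDecayingGap_of_facts` (sub-goal stub `stub_nonDecayingGap_of_facts` of
stmt-SmoothPoincare4-10868): the crux on the bounded non-decaying class modulo F3, F1, F2, CN.
[cite: BernsteinWang2016, Thm 1.2] -/
theorem stub_nonDecayingGap_of_facts : threeShrinkerClassification_modelData → shrinkerSplittingAtInfinity_four → shrinkerPotentialGrowth → CarrilloNi2009_shrinkerLSI → ∀ (M : Type) [TopologicalSpace M] [T2Space M] [SecondCountableTopology M] [ChartedSpace (EuclideanSpace ℝ (Fin 4)) M] [IsManifold (𝓡 4) ∞ M] [ConnectedSpace M] [NoncompactSpace M] [T3Space M] [MeasurableSpace M] [BorelSpace M] (g : PseudoRiemannianMetric (𝓡 4) ∞ (EuclideanSpace ℝ (Fin 4)) (TangentSpace (𝓡 4) : M → Type _)) [g.HasLeviCivita] (f : M → ℝ) (hg : g.IsRiemannian), (∀ (x : M) (r : NNReal), IsCompact {y : M | g.edist hg x y ≤ r}) → ContMDiff (𝓡 4) 𝓘(ℝ, ℝ) ∞ f → (∀ (x : M) (X Y : TangentSpace (𝓡 4) x),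 g.ricci x X Y + g.hessian f x X Y = (1 / 2 : ℝ) * g.val x X Y) → (∀ x : M, g.scalarCurvature x + g.gradSq f x = f x) → (∃ x : M, g.scalarCurvature x ≠ 0) → (∃ C : ℝ, ∀ x : M, g.scalarCurvature x ≤ C) → (∃ ε : ℝ, 0 < ε ∧ ∀ K : Set M, IsCompact K → ∃ x, x ∉ K ∧ ε ≤ g.scalarCurvature x) → ∫⁻ x, ENNReal.ofReal (Real.exp (-f x)) ∂(riemannianMeasure (g.toContMDiffRiemannianMetric hg)) ≤ ENNReal.ofReal (32 * Real.pi ^ 2 * Real.sqrt Real.pi * Real.exp (-(3 : ℝ) / 2)) :=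
  fun hcl hsplit hgrowth hCN M _ _ _ _ _ _ _ _ _ _ g _ f hg hc hf hsol hnorm hnf hbdd hnd ↦
    nonDecayingGap_of_facts hcl hsplit hgrowth hCN M g f hg hc hf hsol hnorm hnf hbdd hnd

/-- Registered form of `noncompactShrinkerGap_of_residues` (sub-goal stub `stub_noncompactShrinkerGap_of_residues` of
stmt-SmoothPoincare4-10868): the four named facts and the two residues imply the crux.
[cite: BernsteinWang2016, Thm 1.2] -/
theorem stub_noncompactShrinkerGap_of_residues : threeShrinkerClassification_modelData → shrinkerSplittingAtInfinity_four → shrinkerPotentialGrowth → CarrilloNi2009_shrinkerLSI → (∀ (M : Type) [TopologicalSpace M] [T2Space M] [SecondCountableTopology M] [ChartedSpace (EuclideanSpace ℝ (Fin 4)) M] [IsManifold (𝓡 4) ∞ M] [ConnectedSpace M] [NoncompactSpace M] [T3Space M] [MeasurableSpace M] [BorelSpace M] (g : PseudoRiemannianMetric (𝓡 4) ∞ (EuclideanSpace ℝ (Fin 4)) (TangentSpace (𝓡 4) : M → Type _)) [g.HasLeviCivita] (f : M → ℝ) (hg : g.IsRiemannian), (∀ (x : M) (r : NNReal), IsCompact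 {y : M | g.edist hg x y ≤ r}) → ContMDiff (𝓡 4) 𝓘(ℝ, ℝ) ∞ f → (∀ (x : M) (X Y : TangentSpace (𝓡 4) x), g.ricci x X Y + g.hessian f x X Y = (1 / 2 : ℝ) * g.val x X Y) → (∀ x : M, g.scalarCurvature x + g.gradSq f x = f x) → (∃ x : M, g.scalarCurvature x ≠ 0) → (∀ ε : ℝ, 0 < ε → ∃ K : Set M, IsCompact K ∧ ∀ x, x ∉ K → g.scalarCurvature x < ε) → ∫⁻ x, ENNReal.ofReal (Real.exp (-f x)) ∂(riemannianMeasure (g.toContMDiffRiemannianMetric hg)) ≤ ENNReal.ofReal (32 * Real.pi ^ 2 * Real.sqrt Real.pi * Real.exp (-(3 : ℝ) / 2))) → (∀ (M : Type) [TopologicalSpace M] [T2Space M] [SecondCountableTopology M] [ChartedSpace (EuclideanSpace ℝ (Fin 4)) M] [IsManifold (𝓡 4) ∞ M] [ConnectedSpace M] [NoncompactSpace M] [T3Space M] [MeasurableSpace M] [BorelSpace M] (g : PseudoRiemannianMetric (𝓡 4) ∞ (EuclideanSpace ℝ (Fin 4)) (TangentSpace (𝓡 4) : M → Type _)) [g.HasLeviCivita]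 (f : M → ℝ) (hg : g.IsRiemannian), (∀ (x : M) (r : NNReal), IsCompact {y : M | g.edist hg x y ≤ r}) → ContMDiff (𝓡 4) 𝓘(ℝ, ℝ) ∞ f → (∀ (x : M) (X Y : TangentSpace (𝓡 4) x), g.ricci x X Y + g.hessian f x X Y = (1 / 2 : ℝ) * g.val x X Y) → (∀ x : M, g.scalarCurvature x + g.gradSq f x = f x) → (∃ x : M, g.scalarCurvature x ≠ 0) → (¬ ∃ C : ℝ, ∀ x : M, g.scalarCurvature x ≤ C) → ∫⁻ x, ENNReal.ofReal (Real.exp (-f x)) ∂(riemannianMeasure (g.toContMDiffRiemannianMetric hg)) ≤ ENNReal.ofReal (32 * Real.pi ^ 2 * Real.sqrt Real.pi * Real.exp (-(3 : ℝ) / 2))) → Summit.SmoothPoincare4.SmoothPoincare4.Theses.EntropyRung.NoncompactShrinkerGap :=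
  fun hcl hsplit hgrowth hCN hC hD ↦ noncompactShrinkerGap_of_residues hcl hsplit hgrowth hCN hC hD

end Summit.SmoothPoincare4.SmoothPoincare4.Theorems.NoncompactShrinkerGapReduction

end
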